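import Mathlib
import Summits.NavierStokesRegularity.NavierStokesRegularity.Theorems.EulerZoomLiouvillePowerGaugeEulerLiouvilleSeparableEulerPast
import HarnessLib

/-!
# Crux `EulerZoomLiouville.PowerGaugeEulerLiouville` (stmt-NavierStokesRegularity-19832), stub `stub_nonSelfSimilarRest`:
# the SEPARABLE DICHOTOMY — a `C¹`-modulated separable past is trivial or an (a.e.) `γ = 0` collapse `W(x)/(T⋆ − τ)`

Helper file (theorems only; `--supports stmt-NavierStokesRegularity-19832`; def-free).  Hand leafhand-ns-eulerzoomliouville-11 g0;
closes the bookkeeping of the separable lane (`…SeparablePast`, `…SeparableEulerBrackets`, `…SeparableEulerPast`).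

* `SeparableEuler.mul_eq_one_of_collapseODE` — the collapse ODE classified: if `θ ∈ C¹`, `θ' = λθ²` on `(−∞,T₁)` and `θ(t₀) ≠ 0` for some
  `t₀ < T₁`, then `θ(t) (θ(t₀)⁻¹ + λt₀ − λt) = 1` for every `t < T₁` (integrating factor for the linear equation satisfied by
  `θ(C − λt) − 1`, constancy on the preconnected open set `(−∞,T₁)`).
* `SeparableEuler.trivial_or_aeCollapseZero` — **THE SEPARABLE DICHOTOMY**: a member with `u(τ, x) = θ(τ) U(x)` a.e. on `(−∞,T₁) × ℝ³`,
  `θ ∈ C¹(ℝ)`, `U` arbitrary, is EITHER trivial (`u = 0` a.e. on the slab: the cases `θ` off the collapse ODE by `…SeparableEulerPast`,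
  `θ ≡ 0`, and `λ = 0` i.e. `θ` constant on the past by `AePastSteady`) OR an a.e. `γ = 0` COLLAPSE: `u(τ, x) = (T⋆ − τ)⁻¹ W(x)` for a.e.
  `(τ, x) ∈ (−∞,T₁) × ℝ³` with `T₁ ≤ T⋆` (`W = λ⁻¹ U`).  The literal form of the latter is the binder `IsOffRateSelfSimilar` (rate
  `g = 0 < 2/5`) of the LEAD skeleton; the a.e.-to-literal bridge is the only bookkeeping left on the separable lane.

WHAT THIS IS NOT: not a proof of the stub or of the crux; nothing about Navier–Stokes. [folklore]
-/

noncomputable section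

-- flat `Theorems/<Route><Decl>…` files of one crux share the namespace of the crux (tree convention)
set_option linter.dupNamespace false

open MeasureTheory Set Filter Topology Metric Function TopologicalSpace
open scoped RealInnerProductSpace NNReal ENNReal

namespace Summit.NavierStokesRegularity.NavierStokesRegularity.Theorems.PowerGaugeEulerLiouville

open Literature.Analysis Literature.Analysis.FunctionSpaces Literature.Analysis.FluidPDE

namespace SeparableEuler

/-- **The collapse ODE classified.**  `θ ∈ C¹`, `θ' = λ θ²` on `(−∞,T₁)`, `θ(t₀) ≠ 0` (`t₀ < T₁`) ⇒
`θ(t) · (θ(t₀)⁻¹ + λ t₀ − λ t) = 1` for all `t < T₁`; in particular `θ` never vanishes there and `θ = 1/(C − λt)`. [folklore] -/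
theorem mul_eq_one_of_collapseODE {θ : ℝ → ℝ} (hθ1 : ContDiff ℝ 1 θ) {l T₁ t₀ : ℝ}
    (hode : ∀ t, t < T₁ → deriv θ t = l * θ t ^ 2) (ht₀ : t₀ < T₁) (hθ₀ : θ t₀ ≠ 0) :
    ∀ t, t < T₁ → θ t * ((θ t₀)⁻¹ + l * t₀ - l * t) = 1 := by
  have hθc : Continuous θ := hθ1.continuous
  have hθd : ∀ t, HasDerivAt θ (deriv θ t) t := fun t => (hθ1.differentiable (by norm_num) t).hasDerivAt
  set C : ℝ := (θ t₀)⁻¹ + l * t₀ with hC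
  -- `y = θ (C − l t) − 1` solves the linear equation `y' = (l θ) y`, `y(t₀) = 0`
  set y : ℝ → ℝ := fun t => θ t * (C - l * t) - 1 with hy
  have hy' : ∀ t, t < T₁ → HasDerivAt y (l * θ t * y t) t := by
    intro t ht
    have h1 : HasDerivAt (fun s => C - l * s) (-(l * 1)) t := ((hasDerivAt_id t).const_mul l).const_sub C
    have h2 := ((hθd t).mul h1).sub_const 1
    have e : deriv θ t * (C - l * t) + θ t * -(l * 1) = l * θ t * y t := by
      rw [hode t ht, hy]; ring
    rw [e] at h2
    exact h2
  have hy₀ : y t₀ = 0 := by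
    simp only [hy, hC]
    field_simp
    ring
  -- integrating factor `E = exp(−∫_{t₀}^t l θ)`
  set F : ℝ → ℝ := fun t => ∫ s in t₀..t, l * θ s with hF
  have hlc : Continuous fun s => l * θ s := continuous_const.mul hθc
  have hF' : ∀ t, HasDerivAt F (l * θ t) t := fun t =>
    intervalIntegral.integral_hasDerivAt_right (hlc.intervalIntegrable _ _) (hlc.stronglyMeasurableAtFilter _ _) hlc.continuousAt
  set Z : ℝ → ℝ := fun t => y t * Real.exp (-F t) with hZ
  have hZ' : ∀ t, t < T₁ → HasDerivAt Z 0 t := by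
    intro t ht
    have hE : HasDerivAt (fun s => Real.exp (-F s)) (Real.exp (-F t) * -(l * θ t)) t := (hF' t).neg.exp
    have h : HasDerivAt Z (l * θ t * y t * Real.exp (-F t) + y t * (Real.exp (-F t) * -(l * θ t))) t :=
      (hy' t ht).mul hE
    exact h.congr_deriv (by ring)
  have hZconst : ∀ t, t < T₁ → Z t = Z t₀ := by
    intro t ht
    refine isOpen_Iio.is_const_of_deriv_eq_zero isPreconnected_Iio (fun s hs => (hZ' s hs).differentiableAt.differentiableWithinAt)
      (fun s hs => (hZ' s hs).deriv) ht ht₀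
  intro t ht
  have h1 : Z t = 0 := by rw [hZconst t ht]; simp [hZ, hy₀]
  have h2 : y t = 0 := by
    have hexp : Real.exp (-F t) ≠ 0 := (Real.exp_pos _).ne'
    simpa [hZ, hexp] using h1
  have h3 : θ t * (C - l * t) = 1 := by rw [hy] at h2; linarith
  simpa [hC] using h3

/-- **THE SEPARABLE DICHOTOMY.**  A member of the class with `u(τ, x) = θ(τ) U(x)` for a.e. `(τ, x) ∈ (−∞,T₁) × ℝ³` (`T₁ ≤ 0`,
`θ ∈ C¹(ℝ)`, `U` arbitrary) is either trivial or an a.e. `γ = 0` collapse `u(τ, x) = (T⋆ − τ)⁻¹ W(x)` on the past slab with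
`T₁ ≤ T⋆`. [folklore] -/
theorem trivial_or_aeCollapseZero {ρ : ℝ} (hρ : 0 < ρ)
    {u : ℝ → EuclideanSpace ℝ (Fin 3) → EuclideanSpace ℝ (Fin 3)} {p : ℝ → EuclideanSpace ℝ (Fin 3) → ℝ}
    {H : ℝ → EuclideanSpace ℝ (Fin 3) → EuclideanSpace ℝ (Fin 3) →L[ℝ] EuclideanSpace ℝ (Fin 3)} {c : ℝ≥0}
    (hsw : IsSuitableWeakSolutionOn (slab (EuclideanSpace ℝ (Fin 3)) (Iio 0) isOpen_Iio) 0 0 u p)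
    (hH : HasWeakSpatialGradientOn (slab (EuclideanSpace ℝ (Fin 3)) (Iio 0) isOpen_Iio) u H)
    (hc : ∀ a : ℝ, 0 < a → ENNReal.ofReal (a ^ (2 * ρ)) * cknA a (0 : ℝ × EuclideanSpace ℝ (Fin 3)) u +
        ENNReal.ofReal (a ^ ρ) * cknE a (0 : ℝ × EuclideanSpace ℝ (Fin 3)) H +
        ENNReal.ofReal (a ^ (2 * ρ)) * cknD a (0 : ℝ × EuclideanSpace ℝ (Fin 3)) p ≤ (c : ℝ≥0∞))
    {T₁ : ℝ} (hT₁ : T₁ ≤ 0) {θ : ℝ → ℝ} (hθ1 : ContDiff ℝ 1 θ) {U : EuclideanSpace ℝ (Fin 3) → EuclideanSpace ℝ (Fin 3)}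
    (hU : ∀ᵐ z ∂(volume.restrict (Iio T₁ ×ˢ (univ : Set (EuclideanSpace ℝ (Fin 3))))), u z.1 z.2 = θ z.1 • U z.2) :
    uncurry u =ᵐ[volume.restrict (Iio (0 : ℝ) ×ˢ (univ : Set (EuclideanSpace ℝ (Fin 3))))] 0 ∨
      ∃ Ts : ℝ, T₁ ≤ Ts ∧ ∃ W : EuclideanSpace ℝ (Fin 3) → EuclideanSpace ℝ (Fin 3),
        ∀ᵐ z ∂(volume.restrict (Iio T₁ ×ˢ (univ : Set (EuclideanSpace ℝ (Fin 3))))), u z.1 z.2 = (Ts - z.1)⁻¹ • W z.2 := by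
  by_cases hode : ∃ l : ℝ, ∀ t, t < T₁ → deriv θ t = l * θ t ^ 2
  swap
  · exact Or.inl (ae_eq_zero_of_gauge_of_aeSeparableEuler hρ hsw hH hc hT₁ hθ1 hode hU)
  obtain ⟨l, hl⟩ := hode
  by_cases hz : ∀ t, t < T₁ → θ t = 0
  · -- `θ ≡ 0` on the past: `u = 0` a.e. there
    left
    have hU' : ∀ᵐ z ∂(volume.restrict (Iio T₁ ×ˢ (univ : Set (EuclideanSpace ℝ (Fin 3))))),
        u z.1 z.2 = (fun _ : EuclideanSpace ℝ (Fin 3) => (0 : EuclideanSpace ℝ (Fin 3))) z.2 := by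
      filter_upwards [hU, ae_restrict_mem (measurableSet_Iio.prod MeasurableSet.univ)] with z hz' hzm
      rw [hz', hz z.1 (mem_prod.1 hzm).1, zero_smul]
    exact AePastSteady.ae_eq_zero_of_gauge_of_aePastSteady hρ hsw hH hc hT₁
      (U := fun _ : EuclideanSpace ℝ (Fin 3) => (0 : EuclideanSpace ℝ (Fin 3))) hU'
  push Not at hz
  obtain ⟨t₀, ht₀, hθ₀⟩ := hz
  have hone := mul_eq_one_of_collapseODE hθ1 hl ht₀ hθ₀
  by_cases hl0 : l = 0
  · -- `θ` constant on the past: a.e. steady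
    left
    have hconst : ∀ t, t < T₁ → θ t = θ t₀ := by
      intro t ht
      have h := hone t ht
      rw [hl0] at h
      simp only [zero_mul, add_zero, sub_zero] at h
      field_simp at h
      linarith [h]
    have hU' : ∀ᵐ z ∂(volume.restrict (Iio T₁ ×ˢ (univ : Set (EuclideanSpace ℝ (Fin 3))))),
        u z.1 z.2 = (fun x => θ t₀ • U x) z.2 := by
      filter_upwards [hU, ae_restrict_mem (measurableSet_Iio.prod MeasurableSet.univ)] with z hz' hzm
      rw [hz', hconst z.1 (mem_prod.1 hzm).1]
    exact AePastSteady.ae_eq_zero_of_gauge_of_aePastSteady hρ hsw hH hc hT₁ (U := fun x => θ t₀ • U x) hU'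
  · -- the `γ = 0` collapse
    right
    set C : ℝ := (θ t₀)⁻¹ + l * t₀ with hC
    refine ⟨C / l, ?_, l⁻¹ • U, ?_⟩
    · by_contra hlt
      push Not at hlt
      have h := hone (C / l) hlt
      have e : (θ t₀)⁻¹ + l * t₀ - l * (C / l) = 0 := by rw [hC]; field_simp; ring
      rw [e, mul_zero] at h
      exact zero_ne_one h
    · filter_upwards [hU, ae_restrict_mem (measurableSet_Iio.prod MeasurableSet.univ)] with z hz' hzm
      have ht : z.1 < T₁ := (mem_prod.1 hzm).1
      have h := hone z.1 ht
      have hne : C - l * z.1 ≠ 0 := by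
        intro h0
        have : θ z.1 * ((θ t₀)⁻¹ + l * t₀ - l * z.1) = 0 := by rw [show (θ t₀)⁻¹ + l * t₀ - l * z.1 = C - l * z.1 by rw [hC], h0, mul_zero]
        rw [this] at h
        exact zero_ne_one h
      have hθz : θ z.1 = (C / l - z.1)⁻¹ * l⁻¹ := by
        have h' : θ z.1 * (C - l * z.1) = 1 := by rw [hC]; simpa [hC] using h
        have hne' : C / l - z.1 ≠ 0 := by
          intro h0
          apply hne
          have : C = l * z.1 := by field_simp at h0; linarith
          rw [this]; ring
        field_simp
        have e : C - l * z.1 = l * (C / l - z.1) := by field_simp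
        rw [e] at h'
        linarith [h']
      rw [hz', hθz, Pi.smul_apply, smul_smul]

end SeparableEuler

/-- **Binder language: THE SEPARABLE DICHOTOMY** — for a member with `u(τ, x) = θ(τ) U(x)` a.e. on `(−∞,T₁) × ℝ³` (`T₁ ≤ 0`,
`θ ∈ C¹(ℝ)`, `U` arbitrary): `u = 0` a.e. on the slab, OR `u` is an a.e. `γ = 0` collapse `(T⋆ − τ)⁻¹ W(x)` on the past slab with
`T₁ ≤ T⋆` (literal form = binder `IsOffRateSelfSimilar`, rate `0 < 2/5`). [folklore] -/
theorem Birth.trivial_or_aeCollapseZero_of_aeSeparableC1 :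
    ∀ ρ : ℝ, 0 < ρ →
      ∀ (u : ℝ → EuclideanSpace ℝ (Fin 3) → EuclideanSpace ℝ (Fin 3)) (p : ℝ → EuclideanSpace ℝ (Fin 3) → ℝ)
        (H : ℝ → EuclideanSpace ℝ (Fin 3) → EuclideanSpace ℝ (Fin 3) →L[ℝ] EuclideanSpace ℝ (Fin 3)) (c : ℝ≥0),
        Birth.InClass ρ u p H c →
          ∀ T₁ : ℝ, T₁ ≤ 0 → ∀ θ : ℝ → ℝ, ContDiff ℝ 1 θ → ∀ U : EuclideanSpace ℝ (Fin 3) → EuclideanSpace ℝ (Fin 3),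
            (∀ᵐ z ∂(volume.restrict (Iio T₁ ×ˢ (univ : Set (EuclideanSpace ℝ (Fin 3))))), u z.1 z.2 = θ z.1 • U z.2) →
            (uncurry u =ᵐ[volume.restrict (Iio (0 : ℝ) ×ˢ (univ : Set (EuclideanSpace ℝ (Fin 3))))] 0 ∨
              ∃ Ts : ℝ, T₁ ≤ Ts ∧ ∃ W : EuclideanSpace ℝ (Fin 3) → EuclideanSpace ℝ (Fin 3),
                ∀ᵐ z ∂(volume.restrict (Iio T₁ ×ˢ (univ : Set (EuclideanSpace ℝ (Fin 3))))),
                  u z.1 z.2 = (Ts - z.1)⁻¹ • W z.2) := by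
  intro ρ hρ u p H c hcl T₁ hT₁ θ hθ1 U hU
  exact SeparableEuler.trivial_or_aeCollapseZero hρ hcl.1 hcl.2.1 hcl.2.2 hT₁ hθ1 hU

end Summit.NavierStokesRegularity.NavierStokesRegularity.Theorems.PowerGaugeEulerLiouville

end
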